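import Literature.RepresentationTheory.FiniteGroups.IrreducibleCharacterCoefficients
import Literature.LinearAlgebra.BaseChange.RationalRelations
import HarnessLib

/-!
# Compatible characters of an amalgam of finite groups separate what compatible class functions separate

Topic `Literature/RepresentationTheory/FiniteGroups`; theorems only (no definition, no named fact).

Let `G_i` (`i ∈ ι`, `ι` finite) be finite groups and `H` a finite group with injective
homomorphisms `φ_i : H → G_i` (the data of an amalgamated free product `∗_H G_i`).  Call a family
of class functions `f_i : G_i → ℂ` **compatible** if `f_i ∘ φ_i = f_j ∘ φ_j` for all `i, j` (these
are exactly the class-function data of the tree of groups; a compatible family of CHARACTERS is the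
character of a finite-dimensional representation of `∗_H G_i`).

**Main theorem** (`exists_compatible_characters_apply_ne`): if a compatible family of class
functions takes different values at `x ∈ G_{i₀}` and `y ∈ G_{j₀}`, then so does some compatible
family of (genuine) characters.  Equivalently: the compatible families of characters span, over
`ℂ`, the fibre product over the class functions of `H` of the spaces of class functions of the
`G_i`.

This is the representation-theoretic core of the "linear" proof that two elements of finite order
of an amalgam of finite groups which are not conjugate are already non-conjugate in a finite
quotient (torsion half of J. L. Dyer's theorem that free-by-finite groups — in particular amalgams of
two finite groups — are conjugacy separable, J. London Math. Soc. (2) 20 (1979); cf. Dyer, J. Austral.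
Math. Soc. A 29 (1980) Thm. 1; the linear method of separating torsion by traces is that of B. Fine
and G. Rosenberger, *Conjugacy separability of Fuchsian groups and related questions*, Contemp.
Math. 109 (1990)): the sequel `CompatibleCharactersFiniteQuotient` realises a separating compatible
family of characters by representations on one space agreeing on `H`, and reduces the resulting
linear group modulo a maximal ideal.

## Proof

Expand `f_i = ∑_χ ⟨f_i, χ⟩ χ` over `Irr(G_i)` (completeness, the tree's
`IsClassFun.eq_sum_classInner_smul`; coefficient calculus in `IrreducibleCharacterCoefficients`).  Compatibility of a family with coefficient system
`w = (w_{i,χ})` is the system of linear equations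
`∑_{χ ∈ Irr G_i} w_{i,χ} ⟨χ ∘ φ_i, κ⟩ = ∑_{χ ∈ Irr G_j} w_{j,χ} ⟨χ ∘ φ_j, κ⟩` (`κ ∈ Irr H`) with
NATURAL-NUMBER coefficients (restriction multiplicities); by the tree's elementary flatness lemma
`Literature.LinearAlgebra.BaseChange.exists_algebraMap_coords` (`ℚ ⊂ ℂ`) the complex solution
`(⟨f_i, χ⟩)` is a `ℂ`-combination of RATIONAL solutions, one of which still separates `x` from `y`.
Clearing denominators and adding a large multiple of the compatible family
`((∏_j |G_j|) / |G_i|) · reg_{G_i}` (which restricts to `(∏_j |G_j|) · δ_1` on `H` for every `i`, by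
injectivity of `φ_i`) makes all coefficients natural numbers, i.e. gives genuine characters.

## References

* J. L. Dyer, *Separating conjugates in amalgamated free products and HNN extensions*, J. Austral.
  Math. Soc. Ser. A 29 (1980) 35–51, Thm. 1. [Dyer1980]
* J.-P. Serre, *Linear Representations of Finite Groups*, GTM 42 (1977), §2.3–§2.5 (orthogonality,
  completeness, regular character). [SerreLinearRepresentations1977]
-/

noncomputable section

open scoped BigOperators

namespace Literature.RepresentationTheory.FiniteGroups

/-! ### Rational vectors: clearing denominators -/

/-- A finite family of rationals has a common denominator. [folklore] -/
private theorem exists_nat_mul_eq_intCast {I : Type} [Fintype I] (w : I → ℚ) :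
    ∃ D : ℕ, 0 < D ∧ ∀ p, ∃ z : ℤ, (D : ℚ) * w p = z := by
  classical
  refine ⟨∏ p, (w p).den, Finset.prod_pos fun p _ => (w p).den_pos, fun p => ?_⟩
  refine ⟨(∏ p' ∈ Finset.univ.erase p, ((w p').den : ℤ)) * (w p).num, ?_⟩
  rw [← Finset.prod_erase_mul _ _ (Finset.mem_univ p)]
  push_cast
  rw [mul_assoc, Rat.den_mul_eq_num]

/-! ### The main theorem -/

section Amalgam

variable {ι : Type} [Fintype ι] [DecidableEq ι] {G : ι → Type} [∀ i, Group (G i)]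
  [∀ i, Fintype (G i)] {H : Type} [Group H] [Fintype H]

/-- **Compatible characters separate what compatible class functions separate.**  Let
`φ_i : H → G_i` be injective homomorphisms of finite groups (`i ∈ ι` finite) and `f_i : G_i → ℂ`
class functions with `f_i ∘ φ_i = f_j ∘ φ_j` for all `i, j`.  If `f_{i₀}(x) ≠ f_{j₀}(y)` then
there are characters `ψ_i` of `G_i` (`IsCharacter`) with `ψ_i ∘ φ_i = ψ_j ∘ φ_j` for all
`i, j` and `ψ_{i₀}(x) ≠ ψ_{j₀}(y)`.  (Torsion half of Dyer's conjugacy separability of amalgams of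
finite groups, representation-theoretic core; see the module docstring.)
[cite: Dyer1980, Thm 1 p.36] -/
theorem exists_compatible_characters_apply_ne (φ : ∀ i, H →* G i)
    (hφ : ∀ i, Function.Injective (φ i)) (f : ∀ i, G i → ℂ) (hf : ∀ i, IsClassFun (f i))
    (hcompat : ∀ i j, f i ∘ φ i = f j ∘ φ j) {i₀ j₀ : ι} {x : G i₀} {y : G j₀}
    (hne : f i₀ x ≠ f j₀ y) :
    ∃ ψ : ∀ i, G i → ℂ, (∀ i, IsCharacter (G i) (ψ i)) ∧ (∀ i j, ψ i ∘ φ i = ψ j ∘ φ j) ∧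
      ψ i₀ x ≠ ψ j₀ y := by
  classical
  -- irreducible characters of the factors and of `H`, as (opaque) finite sets
  obtain ⟨F, hF⟩ : ∃ F : ∀ i, Finset (G i → ℂ), ∀ i χ, χ ∈ F i ↔ IsIrrChar (G i) χ :=
    ⟨fun i => (irrChars_finite_holds (G i)).toFinset, fun i χ => by
      rw [Set.Finite.mem_toFinset]; rfl⟩
  obtain ⟨FH, hFH⟩ : ∃ FH : Finset (H → ℂ), ∀ κ, κ ∈ FH ↔ IsIrrChar H κ :=
    ⟨(irrChars_finite_holds H).toFinset, fun κ => by rw [Set.Finite.mem_toFinset]; rfl⟩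
  have hF' : ∀ i χ, χ ∈ F i → IsIrrChar (G i) χ := fun i χ => (hF i χ).mp
  have hirr : ∀ (i : ι) (χ : ↥(F i)), IsIrrChar (G i) χ := fun i χ => hF' i χ χ.2
  have hirrH : ∀ κ : ↥FH, IsIrrChar H κ := fun κ => (hFH κ).mp κ.2
  -- the combination attached to a coefficient system `w` on `I = Σ i, Irr(G i)`
  obtain ⟨lin, hlin_def⟩ : ∃ lin : ((i : ι) × ↥(F i) → ℂ) → ∀ i, G i → ℂ,
      ∀ w i, lin w i = ∑ χ : ↥(F i), w ⟨i, χ⟩ • (χ : G i → ℂ) := ⟨_, fun _ _ => rfl⟩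
  have hlin_apply : ∀ w i (g : G i), lin w i g = ∑ χ : ↥(F i), w ⟨i, χ⟩ * (χ : G i → ℂ) g := by
    intro w i g
    simp only [hlin_def, Finset.sum_apply, Pi.smul_apply, smul_eq_mul]
  have hlin_class : ∀ w i, IsClassFun (lin w i) := fun w i => by
    rw [hlin_def]; exact isClassFun_sum_smul_irrChars_subtype (hF' i) _
  have hlin_add : ∀ w w' i, lin (w + w') i = lin w i + lin w' i := by
    intro w w' i
    simp only [hlin_def, Pi.add_apply, add_smul, Finset.sum_add_distrib]
  have hlin_smul : ∀ (c : ℂ) w i, lin (c • w) i = c • lin w i := by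
    intro c w i
    simp only [hlin_def, Pi.smul_apply, smul_eq_mul, Finset.smul_sum, ← mul_smul]
  -- restriction multiplicities `⟨χ ∘ φ_i, κ⟩ ∈ ℕ`
  have hmult : ∀ (p : (i : ι) × ↥(F i)) (κ : ↥FH),
      ∃ n : ℕ, classInner ((p.2 : G p.1 → ℂ) ∘ φ p.1) κ = n := fun p κ =>
    ((hirr p.1 p.2).isCharacter.comp (φ p.1)).exists_nat_classInner_eq (hirrH κ)
  choose mult hmult using hmult
  -- `⟨lin w i ∘ φ i, κ⟩ = ∑_χ w_{i,χ} mult`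
  have hlin_comp : ∀ w i (κ : ↥FH), classInner (lin w i ∘ φ i) κ =
      ∑ χ : ↥(F i), w ⟨i, χ⟩ * (mult ⟨i, χ⟩ κ : ℂ) := by
    intro w i κ
    rw [hlin_def, classInner_sum_smul_comp]
    exact Finset.sum_congr rfl fun χ _ => by rw [hmult ⟨i, χ⟩ κ]
  -- compatibility from the coefficient relations
  have hcompat_of : ∀ w : ((i : ι) × ↥(F i) → ℂ),
      (∀ i j (κ : ↥FH), ∑ χ : ↥(F i), w ⟨i, χ⟩ * (mult ⟨i, χ⟩ κ : ℂ) =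
        ∑ χ : ↥(F j), w ⟨j, χ⟩ * (mult ⟨j, χ⟩ κ : ℂ)) →
      ∀ i j, lin w i ∘ φ i = lin w j ∘ φ j := by
    intro w hw i j
    refine ((hlin_class w i).comp_monoidHom (φ i)).eq_of_forall_classInner_eq
      ((hlin_class w j).comp_monoidHom (φ j)) fun κ hκ => ?_
    have := hw i j ⟨κ, (hFH κ).mpr hκ⟩
    rwa [← hlin_comp, ← hlin_comp] at this
  -- the coefficient system of `f`
  obtain ⟨v, hv_def⟩ : ∃ v : (i : ι) × ↥(F i) → ℂ, ∀ p, v p = classInner (f p.1) p.2 :=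
    ⟨_, fun _ => rfl⟩
  have hfv : ∀ i, f i = lin v i := fun i => by
    rw [hlin_def, (hf i).eq_sum_subtype_classInner_smul (hF i)]
    exact Finset.sum_congr rfl fun χ _ => by rw [hv_def]
  have hv_rel : ∀ i j (κ : ↥FH), ∑ χ : ↥(F i), v ⟨i, χ⟩ * (mult ⟨i, χ⟩ κ : ℂ) =
      ∑ χ : ↥(F j), v ⟨j, χ⟩ * (mult ⟨j, χ⟩ κ : ℂ) := by
    intro i j κ
    rw [← hlin_comp, ← hlin_comp, ← hfv, ← hfv, hcompat i j]
  -- the relation sums over `Σ i, Irr(G i)`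
  have hsum_one : ∀ (w : (i : ι) × ↥(F i) → ℂ) (i : ι) (κ : ↥FH),
      ∑ p : (i : ι) × ↥(F i), (if p.1 = i then (mult p κ : ℂ) else 0) * w p =
      ∑ χ : ↥(F i), w ⟨i, χ⟩ * (mult ⟨i, χ⟩ κ : ℂ) := by
    intro w i κ
    rw [Fintype.sum_sigma, Finset.sum_eq_single i]
    · simp only [if_true]
      exact Finset.sum_congr rfl fun χ _ => mul_comm _ _
    · intro i' _ hi'
      simp [hi']
    · intro h; exact absurd (Finset.mem_univ i) h
  -- the relation vectors (rational coefficients) and their sums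
  obtain ⟨r, hr_def⟩ : ∃ r : ι → ι → ↥FH → ((i : ι) × ↥(F i)) → ℚ, ∀ i j κ p,
      r i j κ p = (if p.1 = i then (mult p κ : ℚ) else 0) - (if p.1 = j then (mult p κ : ℚ) else 0) :=
    ⟨_, fun _ _ _ _ => rfl⟩
  have hcast : ∀ (i j : ι) (κ : ↥FH) (p : (i : ι) × ↥(F i)), ((r i j κ p : ℚ) : ℂ) =
      (if p.1 = i then (mult p κ : ℂ) else 0) - (if p.1 = j then (mult p κ : ℂ) else 0) := by
    intro i j κ p
    rw [hr_def]
    push_cast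
    split_ifs <;> simp
  have hsum_rel : ∀ (w : (i : ι) × ↥(F i) → ℂ) (i j : ι) (κ : ↥FH),
      ∑ p : (i : ι) × ↥(F i), ((r i j κ p : ℚ) : ℂ) * w p =
      ∑ χ : ↥(F i), w ⟨i, χ⟩ * (mult ⟨i, χ⟩ κ : ℂ) -
      ∑ χ : ↥(F j), w ⟨j, χ⟩ * (mult ⟨j, χ⟩ κ : ℂ) := by
    intro w i j κ
    simp only [hcast, sub_mul, Finset.sum_sub_distrib, hsum_one]
  -- rational structure: `v` is a `ℂ`-combination of rational solutions of the relations
  obtain ⟨t, c, q, hvq, hrel⟩ :=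
    Literature.LinearAlgebra.BaseChange.exists_algebraMap_coords ℚ (K := ℂ) v
  have hq_rel : ∀ (l : Fin t) i j (κ : ↥FH),
      ∑ χ : ↥(F i), ((q ⟨i, χ⟩ l : ℚ) : ℂ) * (mult ⟨i, χ⟩ κ : ℂ) =
      ∑ χ : ↥(F j), ((q ⟨j, χ⟩ l : ℚ) : ℂ) * (mult ⟨j, χ⟩ κ : ℂ) := by
    intro l i j κ
    have h0 := hrel (r i j κ) (by
        have := hsum_rel v i j κ
        simp only [eq_ratCast]
        rw [this, hv_rel i j κ, sub_self]) l
    have h0' := congrArg (fun r : ℚ => (r : ℂ)) h0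
    simp only [Rat.cast_sum, Rat.cast_mul, Rat.cast_zero] at h0'
    rw [hsum_rel (fun p => ((q p l : ℚ) : ℂ)) i j κ] at h0'
    exact sub_eq_zero.mp h0'
  -- evaluation `E w = lin w i₀ x - lin w j₀ y`; it is `≠ 0` at some rational solution
  have hE : f i₀ x - f j₀ y =
      ∑ l : Fin t, c l * (lin (fun p => ((q p l : ℚ) : ℂ)) i₀ x -
        lin (fun p => ((q p l : ℚ) : ℂ)) j₀ y) := by
    have hx' : ∀ (i : ι) (g : G i), lin v i g =
        ∑ l : Fin t, c l * lin (fun p => ((q p l : ℚ) : ℂ)) i g := by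
      intro i g
      simp only [hlin_apply, Finset.mul_sum]
      rw [Finset.sum_comm]
      refine Finset.sum_congr rfl fun χ _ => ?_
      rw [hvq ⟨i, χ⟩, Finset.sum_mul]
      refine Finset.sum_congr rfl fun l _ => ?_
      simp only [eq_ratCast]
      ring
    rw [hfv i₀, hfv j₀, hx' i₀ x, hx' j₀ y, ← Finset.sum_sub_distrib]
    exact Finset.sum_congr rfl fun l _ => by ring
  have hl : ∃ l : Fin t, lin (fun p => ((q p l : ℚ) : ℂ)) i₀ x ≠
      lin (fun p => ((q p l : ℚ) : ℂ)) j₀ y := by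
    by_contra hcon
    push Not at hcon
    apply hne
    rw [← sub_eq_zero, hE]
    exact Finset.sum_eq_zero fun l _ => by rw [hcon l, sub_self, mul_zero]
  obtain ⟨l₀, hl₀⟩ := hl
  -- clear denominators: `z = D • q(·, l₀)` has integer entries
  obtain ⟨D, hDpos, hDint⟩ := exists_nat_mul_eq_intCast (fun p => q p l₀)
  choose z hz using hDint
  have hzq : (fun p => (z p : ℂ)) = (D : ℂ) • fun p => ((q p l₀ : ℚ) : ℂ) := by
    funext p
    have := congrArg (fun r : ℚ => (r : ℂ)) (hz p)
    simp only [Rat.cast_mul, Rat.cast_natCast, Rat.cast_intCast] at this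
    simp only [Pi.smul_apply, smul_eq_mul]
    exact this.symm
  have hw₁_compat : ∀ i j, lin (fun p => (z p : ℂ)) i ∘ φ i = lin (fun p => (z p : ℂ)) j ∘ φ j := by
    intro i j
    have hq := hcompat_of (fun p => ((q p l₀ : ℚ) : ℂ)) (fun i j κ => hq_rel l₀ i j κ) i j
    rw [hzq, hlin_smul, hlin_smul]
    funext h
    have := congrFun hq h
    simp only [Function.comp_apply] at this
    simp only [Function.comp_apply, Pi.smul_apply, smul_eq_mul, this]
  have hw₁_sep : lin (fun p => (z p : ℂ)) i₀ x - lin (fun p => (z p : ℂ)) j₀ y ≠ 0 := by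
    rw [hzq, hlin_smul, hlin_smul]
    simp only [Pi.smul_apply, smul_eq_mul, ← mul_sub]
    exact mul_ne_zero (Nat.cast_ne_zero.mpr hDpos.ne') (sub_ne_zero.mpr hl₀)
  -- degrees and the compatible positive system `s`
  have hdeg : ∀ p : (i : ι) × ↥(F i), ∃ d : ℕ, 0 < d ∧ (p.2 : G p.1 → ℂ) 1 = d := fun p =>
    (hirr p.1 p.2).exists_apply_one_eq_nat_pos
  choose deg hdeg_pos hdeg_eq using hdeg
  obtain ⟨M, hM_def⟩ : ∃ M : ℕ, M = ∏ i, Fintype.card (G i) := ⟨_, rfl⟩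
  have hMdvd : ∀ i, Fintype.card (G i) ∣ M := fun i =>
    hM_def ▸ Finset.dvd_prod_of_mem _ (Finset.mem_univ i)
  have hMpos : 0 < M := hM_def ▸ Finset.prod_pos fun i _ => Fintype.card_pos
  obtain ⟨s, hs_def⟩ : ∃ s : (i : ι) × ↥(F i) → ℕ,
      ∀ p, s p = (M / Fintype.card (G p.1)) * deg p := ⟨_, fun _ => rfl⟩
  have hs_pos : ∀ p, 1 ≤ s p := by
    intro p
    have h1 : 0 < M / Fintype.card (G p.1) :=
      Nat.div_pos (Nat.le_of_dvd hMpos (hMdvd p.1)) Fintype.card_pos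
    rw [hs_def]
    exact Nat.one_le_iff_ne_zero.mpr (Nat.mul_ne_zero h1.ne' (hdeg_pos p).ne')
  -- `lin s i ∘ φ i = M • δ_1` for every `i`
  have hs_comp : ∀ i (h : H), lin (fun p => (s p : ℂ)) i (φ i h) =
      if h = 1 then (M : ℂ) else 0 := by
    intro i h
    have hreg := sum_subtype_apply_one_smul_irrChars_apply (hF i) (φ i h)
    simp only [Finset.sum_apply, Pi.smul_apply, smul_eq_mul] at hreg
    have : ∀ χ : ↥(F i), (s ⟨i, χ⟩ : ℂ) * (χ : G i → ℂ) (φ i h) =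
        ((M / Fintype.card (G i) : ℕ) : ℂ) * ((χ : G i → ℂ) 1 * (χ : G i → ℂ) (φ i h)) := by
      intro χ
      rw [hs_def, Nat.cast_mul, ← hdeg_eq ⟨i, χ⟩, mul_assoc]
    simp only [hlin_apply, this, ← Finset.mul_sum, hreg, map_eq_one_iff (φ i) (hφ i)]
    split_ifs with h1
    · rw [← Nat.cast_mul, Nat.div_mul_cancel (hMdvd i)]
    · rw [mul_zero]
  -- a bound `T₀` for the integer coefficients
  obtain ⟨T₀, hT₀_def⟩ : ∃ T₀ : ℕ, T₀ = ∑ p, (z p).natAbs := ⟨_, rfl⟩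
  have hT₀ : ∀ p, -(T₀ : ℤ) ≤ z p := by
    intro p
    have h1 : (z p).natAbs ≤ T₀ :=
      hT₀_def ▸ Finset.single_le_sum (f := fun p => (z p).natAbs) (fun _ _ => Nat.zero_le _)
        (Finset.mem_univ p)
    omega
  -- choose `T ∈ {T₀, T₀ + 1}` keeping the separation
  have hT : ∃ T : ℕ, T₀ ≤ T ∧
      (lin (fun p => (z p : ℂ)) i₀ x - lin (fun p => (z p : ℂ)) j₀ y) +
        (T : ℂ) * (lin (fun p => (s p : ℂ)) i₀ x - lin (fun p => (s p : ℂ)) j₀ y) ≠ 0 := by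
    by_cases h0 : (lin (fun p => (z p : ℂ)) i₀ x - lin (fun p => (z p : ℂ)) j₀ y) +
        (T₀ : ℂ) * (lin (fun p => (s p : ℂ)) i₀ x - lin (fun p => (s p : ℂ)) j₀ y) = 0
    · refine ⟨T₀ + 1, Nat.le_succ _, fun h1 => ?_⟩
      push_cast at h1
      have hb : lin (fun p => (s p : ℂ)) i₀ x - lin (fun p => (s p : ℂ)) j₀ y = 0 := by
        linear_combination h1 - h0
      exact hw₁_sep (by linear_combination h0 - (T₀ : ℂ) * hb)
    · exact ⟨T₀, le_rfl, h0⟩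
  obtain ⟨T, hT₀T, hTsep⟩ := hT
  -- the final coefficient system `n = z + T • s` has natural-number entries
  have hnat : ∀ p, ∃ n : ℕ, (z p : ℤ) + T * s p = n := by
    intro p
    have h1 : (0 : ℤ) ≤ z p + T * s p := by
      have := hT₀ p
      have h2 : (T₀ : ℤ) ≤ T * s p := by
        calc (T₀ : ℤ) ≤ T := by exact_mod_cast hT₀T
          _ = T * 1 := (mul_one _).symm
          _ ≤ T * s p :=
            mul_le_mul_of_nonneg_left (by exact_mod_cast hs_pos p) (by positivity)
      omega
    exact ⟨(z p + T * s p).toNat, (Int.toNat_of_nonneg h1).symm⟩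
  choose n hn using hnat
  have hw' : (fun p => (n p : ℂ)) = (fun p => (z p : ℂ)) + (T : ℂ) • (fun p => (s p : ℂ)) := by
    funext p
    simp only [Pi.add_apply, Pi.smul_apply, smul_eq_mul]
    have := congrArg (fun r : ℤ => (r : ℂ)) (hn p)
    push_cast at this
    exact this.symm
  refine ⟨fun i => lin (fun p => (n p : ℂ)) i, fun i => ?_, fun i j => ?_, ?_⟩
  · -- characters
    show IsCharacter (G i) (lin (fun p => (n p : ℂ)) i)
    rw [hlin_def]
    exact isCharacter_sum_subtype_natCast_smul_irrChars (hF' i) (fun χ => n ⟨i, χ⟩)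
  · -- compatibility
    show lin (fun p => (n p : ℂ)) i ∘ φ i = lin (fun p => (n p : ℂ)) j ∘ φ j
    rw [hw', hlin_add, hlin_add, hlin_smul, hlin_smul]
    funext h
    have h1 := congrFun (hw₁_compat i j) h
    simp only [Function.comp_apply] at h1
    simp only [Function.comp_apply, Pi.add_apply, Pi.smul_apply, smul_eq_mul, h1, hs_comp]
  · -- separation
    show lin (fun p => (n p : ℂ)) i₀ x ≠ lin (fun p => (n p : ℂ)) j₀ y
    rw [hw', hlin_add, hlin_add, hlin_smul, hlin_smul]
    intro heq
    apply hTsep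
    simp only [Pi.add_apply, Pi.smul_apply, smul_eq_mul] at heq
    linear_combination heq

end Amalgam

end Literature.RepresentationTheory.FiniteGroups

end
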